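import Literature.AlgebraicGeometry.Motives.SupersingularLefschetzOfDeuring
import Literature.AlgebraicGeometry.Motives.AbelianVarietyImageSimpleProofs
import Literature.AlgebraicGeometry.Motives.AbelianVarietyEndAlgebraSemisimpleProofs
import Literature.AlgebraicGeometry.Motives.FaltingsECTateNoncommutativeProofs
import Mathlib.LinearAlgebra.Matrix.ToLin
import Mathlib.FieldTheory.IsAlgClosed.Basic
import HarnessLib

/-!
# Lenstra–Zarhin for supersingular abelian varieties, reduced to the non-commutativity of `End E`

Second assembly for the named fact `LenstraZarhin1993_supersingular_lefschetzClasses_eq_top`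
(`Motives/SupersingularAbelianVariety`; Lenstra–Zarhin 1993, §1, p. 179: on a supersingular
abelian variety over an algebraically closed field every even-degree cohomology class is a
Lefschetz class), for an arbitrary Weil cohomology theory `W` (Kleiman 1968, §1.2), sharpening
`LenstraZarhin1993_supersingular_lefschetzClasses_eq_top_of_deuring`
(`Motives/SupersingularLefschetzOfDeuring`): there the residual input was Deuring's theorem in the
form "`End⁰(E)` is a finite-dimensional central simple `ℚ`-algebra of dimension `4`" for the
supersingular elliptic curves `E/k̄`; here it is only

> for every supersingular elliptic curve `E` over `k̄ = AlgebraicClosure k`, the ring `End E` is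
> **not commutative**

(Deuring 1941: the endomorphism ring of a supersingular elliptic curve is an order in a quaternion
algebra, in particular non-commutative; Silverman, *AEC* V.3.1 (a)). A central simple algebra of
dimension `4` being non-commutative, the new hypothesis is implied by the old one
(`AbelianVariety.exists_mul_ne_mul_of_isCentral_endAlgebra`); it no longer involves the
finite-dimensionality of `End⁰(E)`.

* `span_subring_end_eq_top_of_mul_ne`: the tree's `span_subring_eq_top_of_mul_ne`
  (`Motives/FaltingsECTateNoncommutativeProofs`: a non-commutative subring of `M₂(L)` whose
  non-zero elements are invertible spans `M₂(L)`), transported to `End_L V`, `dim V = 2`.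
* `WeilCohomology.span_pullback_one_eq_top_of_mul_ne`: for a one-dimensional abelian variety `E`
  with two non-commuting endomorphisms, the pull-backs `f*|H¹(E)` span `End_K H¹(E)`: `f ↦ f*|H¹`
  is a ring anti-homomorphism (`pullback_mul_deg_one`), a non-zero `f` is an isogeny
  (`isIsogeny_of_isSimple_of_ne_zero_end`, elliptic curves are simple) and so acts invertibly on
  `H¹(E)` (`surjective_pullback_of_isIsogeny`); hence the image of `End E` is a non-commutative
  subring of `End_K H¹(E) ≅ M₂(K)` without non-zero singular elements.
* `LenstraZarhin1993_supersingular_lefschetzClasses_eq_top_of_noncommutative`: **the named fact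
  for every `A`, granted the non-commutativity of `End E`** for the supersingular elliptic curves
  `E/k̄`; the rest of the proof is that of `…_of_deuring` (base change back along `k ≅ k̄`, graph
  classes on `E'^{g+1}`, exterior algebra and polarization, transfer along the isogeny).

Everything is a theorem; no definitions, no named facts.

## References

* [LenstraZarhin1993] H. W. Lenstra, Jr., Yu. G. Zarhin, *The Tate conjecture for almost ordinary
  abelian varieties over finite fields*, Advances in Number Theory (1993), §1, p. 179.
* [Deuring1941] M. Deuring, *Die Typen der Multiplikatorenringe elliptischer Funktionenkörper*,
  Abh. Math. Sem. Hamburg 14 (1941), 197–272.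
* [SilvermanAEC2009] J. H. Silverman, *The Arithmetic of Elliptic Curves*, 2nd ed., Thm. V.3.1.
* [Tate1966Endomorphisms] J. Tate, *Endomorphisms of abelian varieties over finite fields*,
  Invent. Math. 2 (1966), §2 (the bicommutant step).
* [Kleiman1968] S. Kleiman, *Algebraic cycles and the Weil conjectures* (1968), §1.2.
-/

noncomputable section

universe u v

open CategoryTheory AlgebraicGeometry
open scoped TensorProduct MonObj

namespace Literature.AlgebraicGeometry.Motives

/-! ## Non-commutative subrings of `End_L V`, `dim V = 2` -/

section LinearAlgebra

/-- **A non-commutative subring of `End_L V` (`dim_L V = 2`, `2 ≠ 0` in `L`) all of whose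
non-zero elements are invertible spans `End_L V` over `L`**: the tree's
`span_subring_eq_top_of_mul_ne` for `M₂(L)`, transported along `End_L V ≃ₐ M₂(L)` given by a
basis (Tate 1966, §2, the bicommutant step of the proof of the isogeny theorem; elementary).
[folklore] -/
theorem span_subring_end_eq_top_of_mul_ne {L V : Type*} [Field L] [AddCommGroup V] [Module L V]
    [FiniteDimensional L V] (h2 : (2 : L) ≠ 0) (hV : Module.finrank L V = 2)
    (R : Subring (Module.End L V)) (hR : ∀ r ∈ R, r ≠ 0 → IsUnit r)
    {r s : Module.End L V} (hr : r ∈ R) (hs : s ∈ R) (hrs : r * s ≠ s * r) :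
    Submodule.span L (R : Set (Module.End L V)) = ⊤ := by
  classical
  let b := Module.finBasisOfFinrankEq L V hV
  let e : Module.End L V ≃ₐ[L] Matrix (Fin 2) (Fin 2) L := LinearMap.toMatrixAlgEquiv b
  let R' : Subring (Matrix (Fin 2) (Fin 2) L) := R.map e.toRingEquiv.toRingHom
  have hR' : ∀ r' ∈ R', r' ≠ 0 → IsUnit r' := by
    rintro _ ⟨x, hx, rfl⟩ hx0
    refine (hR x hx fun h ↦ hx0 ?_).map _
    change e x = 0
    rw [h, map_zero]
  have hr' : e r ∈ R' := Subring.mem_map.2 ⟨r, hr, rfl⟩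
  have hs' : e s ∈ R' := Subring.mem_map.2 ⟨s, hs, rfl⟩
  have hrs' : e r * e s ≠ e s * e r := fun h ↦ hrs (e.injective (by rwa [map_mul, map_mul]))
  have h' := span_subring_eq_top_of_mul_ne h2 R' hR' hr' hs' hrs'
  have hset : (R' : Set (Matrix (Fin 2) (Fin 2) L)) = e.toLinearMap '' (R : Set (Module.End L V)) :=
    Subring.coe_map _ _
  rw [hset, ← Submodule.map_span] at h'
  have hinj : Function.Injective e.toLinearMap := fun x y hxy ↦ e.injective hxy
  have h'' := congrArg (Submodule.comap e.toLinearMap) h'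
  rwa [Submodule.comap_map_eq_of_injective hinj, Submodule.comap_top] at h''

end LinearAlgebra

/-! ## The pull-backs of the endomorphisms of an elliptic curve with non-commutative `End` -/

namespace WeilCohomology

variable {k : Type u} [Field k] {K : Type v} [Field K] [CharZero K] (W : WeilCohomology k K)
variable (E : AbelianVariety k)

/-- **Two non-commuting endomorphisms make the `f*|H¹(E)` span `End_K H¹(E)`.** Let `E` be a
one-dimensional abelian variety over `k` with endomorphisms `f, g`, `f g ≠ g f`. Then for every
Weil cohomology theory `W` the operators `p*|H¹(E)`, `p : E → E` a `k`-morphism, span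
`End_K H¹(E)` over `K`. Indeed `f ↦ f*|H¹(E)` is a ring anti-homomorphism on `End E`
(`pullback_mul_deg_one`), a non-zero endomorphism of the simple abelian variety `E` is an
isogeny (`isIsogeny_of_isSimple_of_ne_zero_end`) and so acts invertibly on the plane `H¹(E)`
(`surjective_pullback_of_isIsogeny`); thus the image of `End E` is a non-commutative subring of
`End_K H¹(E)` without non-zero singular elements, which spans (`span_subring_end_eq_top_of_mul_ne`;
Tate 1966, §2). For a supersingular elliptic curve the hypothesis is (the easy half of the
statement of) Deuring's theorem, Silverman *AEC* V.3.1 (a). [cite: SilvermanAEC2009, V.3.1] -/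
theorem span_pullback_one_eq_top_of_mul_ne (hE1 : E.dim = 1) {f g : End E} (hfg : f * g ≠ g * f) :
    Submodule.span K (Set.range fun p : E.X ⟶ E.X ↦ W.pullback p 1) = ⊤ := by
  classical
  have hE : IsSmoothProjective 1 E.X := hE1 ▸ (AbelianVariety.isSmoothProjective_holds (A := E))
  haveI := W.finite_obj hE 1
  -- `dim H¹(E) = 2`
  have h2 : Module.finrank K (W.obj E.X 1) = 2 := by
    obtain ⟨w, hw⟩ := W.exists_pow_ne_zero hE
    have := W.eq_two_mul_dim E hE hw (Module.finBasis K (W.obj E.X 1))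
    omega
  haveI : Nontrivial (W.obj E.X 1) := Module.nontrivial_of_finrank_pos (R := K) (by omega)
  set V := W.obj E.X 1
  -- `ρ : End E → End_K H¹(E)`, `f ↦ f*`, is additive …
  let ρ : End E →+ Module.End K V :=
    AddMonoidHom.mk' (fun f ↦ W.pullback f.hom.hom.hom 1) fun f f' ↦ LinearMap.ext fun v ↦ by
      change W.pullback (f.hom.hom.hom * f'.hom.hom.hom) 1 v = _
      rw [W.pullback_mul_deg_one E hE, LinearMap.add_apply]
  have hρ : ∀ f : End E, ρ f = W.pullback f.hom.hom.hom 1 := fun _ ↦ rfl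
  -- … unital and anti-multiplicative
  have hρ1 : ρ 1 = 1 := by
    rw [hρ]
    change W.pullback (𝟙 E.X) 1 = 1
    rw [W.pullback_id]
    rfl
  have hρmul : ∀ f f' : End E, ρ (f' * f) = ρ f * ρ f' := fun f f' ↦ by
    rw [hρ, hρ, hρ]
    change W.pullback (f.hom.hom.hom ≫ f'.hom.hom.hom) 1 = _
    rw [W.pullback_comp, Module.End.mul_eq_comp]
  -- non-zero endomorphisms are isogenies and act invertibly on `H¹(E)`
  have hunit : ∀ x : End E, x ≠ 0 → IsUnit (ρ x) := fun x hx ↦ by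
    have hiso := AbelianVariety.isIsogeny_of_isSimple_of_ne_zero_end
      (AbelianVariety.isSimple_of_dim_le_one hE1.le) x hx
    rw [hρ, LinearMap.isUnit_iff_range_eq_top]
    exact LinearMap.range_eq_top.2 (W.surjective_pullback_of_isIsogeny hiso 1)
  have hfaith : ∀ x : End E, ρ x = 0 → x = 0 := fun x hx ↦ by
    by_contra hx0
    exact (hunit x hx0).ne_zero hx
  -- the image subring `R = ρ(End E) ⊆ End_K H¹(E)`
  let R : Subring (Module.End K V) :=
    { carrier := Set.range ρ
      mul_mem' := by
        rintro _ _ ⟨f, rfl⟩ ⟨f', rfl⟩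
        exact ⟨f' * f, hρmul f f'⟩
      one_mem' := ⟨1, hρ1⟩
      add_mem' := by
        rintro _ _ ⟨f, rfl⟩ ⟨f', rfl⟩
        exact ⟨f + f', map_add ρ f f'⟩
      zero_mem' := ⟨0, map_zero ρ⟩
      neg_mem' := by
        rintro _ ⟨f, rfl⟩
        exact ⟨-f, map_neg ρ f⟩ }
  have hR : ∀ r ∈ R, r ≠ 0 → IsUnit r := by
    rintro _ ⟨x, rfl⟩ hx0
    exact hunit x fun h ↦ hx0 (by rw [h, map_zero])
  -- `ρ g` and `ρ f` do not commute, since `ρ` is faithful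
  have hne : ρ g * ρ f ≠ ρ f * ρ g := by
    intro h
    rw [← hρmul, ← hρmul] at h
    exact hfg (sub_eq_zero.1 (hfaith _ (by rw [map_sub, h, sub_self])))
  have htop := span_subring_end_eq_top_of_mul_ne two_ne_zero h2 R hR ⟨g, rfl⟩ ⟨f, rfl⟩ hne
  -- `R ⊆ {p* : p : E → E}`
  rw [eq_top_iff, ← htop, Submodule.span_le]
  rintro _ ⟨x, rfl⟩
  exact Submodule.subset_span ⟨x.hom.hom.hom, rfl⟩

end WeilCohomology

/-! ## The old hypothesis implies the new one -/

namespace AbelianVariety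

variable {k : Type u} [Field k]

/-- **A central `End⁰(E)` of `ℚ`-dimension `≠ 1` forces `End E` to be non-commutative**: if all
endomorphisms of `E` commuted, `End⁰(E) = ℚ ⊗ End E` would be commutative, hence equal to its
centre `ℚ`, of dimension `1`. In particular the hypothesis of
`LenstraZarhin1993_supersingular_lefschetzClasses_eq_top_of_deuring` (central simple of dimension
`4`) implies that of `…_of_noncommutative` below. [folklore] -/
theorem exists_mul_ne_mul_of_isCentral_endAlgebra (E : AbelianVariety k)
    [Algebra.IsCentral ℚ E.endAlgebra] (hd : 1 < Module.finrank ℚ E.endAlgebra) :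
    ∃ f g : End E, f * g ≠ g * f := by
  by_contra! hcomm
  -- `End⁰(E) = ℚ ⊗ End E` is commutative: its elements are `M⁻¹ (1 ⊗ F)`
  have key : ∀ (a b : ℚ) (F G : End E),
      algebraMap ℚ E.endAlgebra a * endAlgebra.of E F * (algebraMap ℚ E.endAlgebra b *
        endAlgebra.of E G) = algebraMap ℚ E.endAlgebra (a * b) * endAlgebra.of E (F * G) := by
    intro a b F G
    rw [map_mul, map_mul, mul_assoc, ← mul_assoc (endAlgebra.of E F), ← Algebra.commutes b]
    simp only [mul_assoc]
  have hc' : ∀ x y : E.endAlgebra, x * y = y * x := by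
    intro x y
    obtain ⟨M, F, -, rfl⟩ := endAlgebra.exists_eq_algebraMap_mul_of x
    obtain ⟨P, G, -, rfl⟩ := endAlgebra.exists_eq_algebraMap_mul_of y
    rw [key, key, mul_comm ((P : ℚ)⁻¹) ((M : ℚ)⁻¹), hcomm G F]
  -- so every element of `End⁰(E)` is central, hence a scalar
  have hcen : ∀ d : E.endAlgebra, d ∈ Subalgebra.center ℚ E.endAlgebra := fun d ↦
    Subalgebra.mem_center_iff.2 fun d' ↦ hc' d' d
  -- so `ℚ → End⁰(E)` is onto and `dim End⁰(E) ≤ 1`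
  have hsurj : Function.Surjective (Algebra.linearMap ℚ E.endAlgebra) := fun d ↦ by
    obtain ⟨q, hq⟩ := (Algebra.IsCentral.mem_center_iff ℚ).1 (hcen d)
    exact ⟨q, hq.symm⟩
  have hle : Module.finrank ℚ E.endAlgebra ≤ 1 := by
    have h := LinearMap.finrank_range_le (Algebra.linearMap ℚ E.endAlgebra)
    rwa [LinearMap.range_eq_top.2 hsurj, finrank_top, Module.finrank_self] at h
  omega

end AbelianVariety

/-! ## The assembly -/

variable {k : Type u} [Field k] {K : Type v} [Field K] [CharZero K] (W : WeilCohomology k K)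

/-- **Lenstra–Zarhin for supersingular abelian varieties, granted the non-commutativity of the
endomorphism rings of supersingular elliptic curves.** Let `k` be algebraically closed, `W` a
Weil cohomology theory over `k` and `A` a supersingular abelian variety over `k` (`A ⊗ k̄ ∼ Eᵍ`,
`E[p](k̄) = 0`). If every supersingular elliptic curve `E` over `k̄ = AlgebraicClosure k` has two
non-commuting endomorphisms (Deuring 1941: `End E` is an order in a quaternion algebra;
Silverman, *AEC* V.3.1 (a)), then every class in every `H²ʳ(A)` is a Lefschetz class
(Lenstra–Zarhin 1993, §1, p. 179). The proof is that of
`LenstraZarhin1993_supersingular_lefschetzClasses_eq_top_of_deuring` with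
`span_pullback_one_eq_top_of_mul_ne` in place of `span_pullback_one_eq_top_of_endAlgebra`:
base change back along `k ≅ k̄` (`Motives/BaseChangeAlongInverse`) gives `E' = E ×_{k̄} k` over
`k` with `End E' ≅ End E` still non-commutative; all classes on `E'^{g+1}` are Lefschetz
(`lefschetzClasses_powSucc_eq_top`), and they transfer to `(E^{g+1}) ×_{k̄} k ≅ E'^{g+1}`, along
the base-changed isogeny to `(A ⊗ k̄) ×_{k̄} k`, and to `A ≅ (A ⊗ k̄) ×_{k̄} k`.
[cite: LenstraZarhin1993, §1 p. 179] -/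
theorem LenstraZarhin1993_supersingular_lefschetzClasses_eq_top_of_noncommutative
    (A : AbelianVariety k)
    (hD : ∀ E : AbelianVariety (AlgebraicClosure k), E.IsSupersingularEllipticCurve →
      ∃ f g : End E, f * g ≠ g * f) :
    LenstraZarhin1993_supersingular_lefschetzClasses_eq_top W A := by
  intro _ hA r
  rcases hdim : A.dim with _ | g
  · exact LenstraZarhin1993_supersingular_lefschetzClasses_eq_top_of_dim_eq_zero W A hdim hA r
  obtain ⟨E, hE, hiso⟩ := (AbelianVariety.isSupersingular_iff_of_dim_eq_succ hdim).1 hA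
  -- `k ≅ k̄`, and the inverse isomorphism as an algebra structure `k̄ → k`
  let e : k ≃+* AlgebraicClosure k := RingEquiv.ofBijective (algebraMap k (AlgebraicClosure k))
    (IsAlgClosed.algebraMap_bijective_of_isIntegral (k := k) (K := AlgebraicClosure k))
  letI : Algebra (AlgebraicClosure k) k := e.symm.toRingHom.toAlgebra
  have hk : ∀ x : k, algebraMap (AlgebraicClosure k) k (algebraMap k (AlgebraicClosure k) x) = x :=
    fun x ↦ e.symm_apply_apply x
  have hkb : ∀ y : AlgebraicClosure k,
      algebraMap k (AlgebraicClosure k) (algebraMap (AlgebraicClosure k) k y) = y :=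
    fun y ↦ e.apply_symm_apply y
  -- `E' = E ×_{k̄} k`: a one-dimensional abelian variety over `k` with `End E' ≅ End E`
  have hE'1 : (E.baseChange k).dim = 1 := by rw [AbelianVariety.dim_baseChange]; exact hE.1
  obtain ⟨φ, ψ, hφψ⟩ := hD E hE
  let eEnd := AbelianVariety.endRingEquivOfInverse k hkb hk E
  have hφψ' : eEnd φ * eEnd ψ ≠ eEnd ψ * eEnd φ := fun h ↦
    hφψ (eEnd.injective (by rwa [map_mul, map_mul]))
  have hspan := W.span_pullback_one_eq_top_of_mul_ne (E.baseChange k) hE'1 hφψ'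
  -- all classes on `E'^{g+1}` are Lefschetz classes
  have h1 : W.lefschetzClasses ((E.baseChange k).powSucc g).X r = ⊤ :=
    W.lefschetzClasses_powSucc_eq_top (E.baseChange k) hE'1 hspan g r
  -- transfer to `(E^{g+1}) ×_{k̄} k ≅ E'^{g+1}`
  have h2 : W.lefschetzClasses ((E.powSucc g).baseChange k).X r = ⊤ :=
    W.lefschetzClasses_eq_top_of_iso AbelianVariety.isSmoothProjective_holds
      AbelianVariety.isSmoothProjective_holds (AbelianVariety.powSuccBaseChangeXIso k E g) r h1
  -- along the base-changed isogeny `(A ⊗ k̄) ×_{k̄} k → (E^{g+1}) ×_{k̄} k`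
  have h3 : W.lefschetzClasses ((A.baseChange (AlgebraicClosure k)).baseChange k).X r = ⊤ :=
    W.lefschetzClasses_eq_top_of_isIsogenous (AbelianVariety.IsIsogenous.baseChange k hiso) r h2
  -- and back to `A ≅ (A ⊗ k̄) ×_{k̄} k`
  exact W.lefschetzClasses_eq_top_of_iso AbelianVariety.isSmoothProjective_holds
    AbelianVariety.isSmoothProjective_holds
    (AbelianVariety.baseChangeBaseChangeXIso (AlgebraicClosure k) hk hkb A).symm r h3

/-- The previous assembly recovers `…_of_deuring`: a central simple `End⁰(E)` of dimension `4`
is non-commutative (`exists_mul_ne_mul_of_isCentral_endAlgebra`). [cite: LenstraZarhin1993, §1 p. 179] -/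
theorem LenstraZarhin1993_supersingular_lefschetzClasses_eq_top_of_deuring' (A : AbelianVariety k)
    (hD : ∀ E : AbelianVariety (AlgebraicClosure k), E.IsSupersingularEllipticCurve →
      Algebra.IsCentral ℚ E.endAlgebra ∧ Module.finrank ℚ E.endAlgebra = 4) :
    LenstraZarhin1993_supersingular_lefschetzClasses_eq_top W A :=
  LenstraZarhin1993_supersingular_lefschetzClasses_eq_top_of_noncommutative W A fun E hE ↦ by
    obtain ⟨hc, h4⟩ := hD E hE
    haveI := hc
    exact E.exists_mul_ne_mul_of_isCentral_endAlgebra (by omega)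

end Literature.AlgebraicGeometry.Motives

end
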